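/-
Copyright (c) 2026. All rights reserved.
Released under Apache 2.0 license as described in the file LICENSE.
-/
import Literature.NumberTheory.ComplexMultiplication.DegenerateCMTypesElementaryAbelianTwoGroup
import HarnessLib

/-!
# Rank `2` on ANY finite abelian group: a CM type has Kubota rank `2` iff it is a coset of an index-`2` subgroup
# not containing `ρ` — Parseval and a variance identity

Setting of the tree's `CMTypeRankCharacters` (T. Kubota [Kubota1965] §4 Lemma 2 = B. B. Gordon
[Gordon1999HodgeAVSurvey] Prop. 9.4.1: `rank(T) = 1 + #{χ : χ(ρ) = −1, Ŝ(χ) ≠ 0}`, `Ŝ(χ) = Σ_{t∈T} χ(t)`) for a CM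
type `T` (w.r.t. `ρ`) on a finite commutative group `G`.  The tree's `DegenerateCMTypesElementaryAbelianTwoGroup`
(`ExponentTwo.typeRank_eq_two_iff_exists_subgroup`, seat p10 g37-#3) proved, for `G` of EXPONENT `2`, that
`rank(T) = 2` iff `T = H` or `T = G ∖ H` for a subgroup `H ∌ ρ` of index `2`, using that character sums are then
integers.  THIS FILE removes the exponent-`2` hypothesis:

> **Theorem** (`typeRank_eq_two_iff_exists_subgroup`).  For a CM type `T` on a finite commutative group `G`,
> `rank(T) = 2` iff there is a subgroup `H ≤ G` with `ρ ∉ H`, `[G : H] = 2` and `T ∈ {H, G ∖ H}`; iff some odd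
> character is constant on `T` (`typeRank_eq_two_iff_exists_forall_eq`).

On the field side (`G = Gal(K/ℚ)`, `K` an abelian CM field) this is the minimal-rank statement `Rank(Φ) = 2 ⟺ Φ` is
induced from an imaginary quadratic subfield (G. Shimura [Shimura1998] §8.4 Example (2)(A); K. A. Ribet's bound
`rank ≥ 2 + log₂` on the primitive core, tree `cmTypeRank_eq_two_iff_exists_inducedCMType_quadratic` for every CM
field); here it is obtained inside the character calculus, for the abstract types of the group-level dictionary.

PROOF.  `⟸`: the sign character `χ₀` of `G/H` is odd and constant (`= c`) on `T`; every other odd `χ` is `ψχ₀`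
with `ψ = χχ₀⁻¹` even and non-trivial, and even non-trivial characters vanish on a CM type (tree
`ExponentTwo.sum_char_eq_zero_of_even`, valid on every `G`), so `Ŝ(χ) = c·Σ_T ψ = 0`: exactly one survivor.
`⟹`: rank `2` leaves ONE surviving odd character `χ₀` (Kubota).  PARSEVAL on `G` (§1,
`sum_normSq_sum_char_eq`: `Σ_χ |Ŝ_S(χ)|² = |G|·|S|` for every `S ⊆ G`) restricted to a CM type (§2,
`sum_odd_normSq_sum_char_eq`: `Σ_{χ odd} |Ŝ(χ)|² = |T|²`, the trivial character giving `|T|²` and the even ones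
nothing) forces `|Ŝ(χ₀)| = |T|` (§3).  Instead of the equality case of the triangle inequality we use the VARIANCE
IDENTITY (§3, `forall_eq_of_normSq_sum_char_eq`): with `c = Ŝ(χ₀)/|T|`, `|c| = 1` and
`Σ_{t∈T} |χ₀(t) − c|² = |T| + |T|·|c|² − 2·Re(Ŝ(χ₀)·c̄) = 2|T| − 2|T| = 0`, so `χ₀ ≡ c` on `T`; then `T` lies in
one fibre of `χ₀`, a coset of `H = ker χ₀` with `|H| ≤ |G|/2 = |T|` (`χ₀ ≠ 1`), whence `T` is that coset and
`[G : H] = 2` (§4).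

* §1 `sum_mul_conj_sum_char_eq`, `sum_normSq_sum_char_eq` (Parseval for subsets of a finite commutative group).
* §2 `sum_odd_normSq_sum_char_eq` (CM types: `Σ_{odd} |Ŝ|² = |T|²`), `exists_odd_sum_char_ne_zero`.
* §3 `forall_eq_of_normSq_sum_char_eq` (variance: `|Ŝ_S(χ)|² = |S|²` ⟹ `χ` constant on `S`),
  `normSq_sum_char_eq_of_typeRank_eq_two` (rank `2`: the survivor has `|Ŝ|² = |T|²`),
  `typeRank_eq_two_of_forall_eq`, **`typeRank_eq_two_iff_exists_forall_eq`**.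
* §4 **`typeRank_eq_two_iff_exists_subgroup`**, `exists_subgroup_of_forall_eq` (an odd character constant on a CM
  type has kernel of index `2`, and the type is one of its two cosets).

HONEST SCOPE.  Character orthogonality (Mathlib `AddChar.sum_apply_eq_ite`) and Kubota's count; the sources print the
rank formula and the field-side statement (rank `2` ⟺ imaginary quadratic core); the group-level packaging and the
variance route are this file's.  THEOREMS ONLY: no definition, no named fact, no instance, no `sorry`.

## References

* [Kubota1965] T. Kubota, *On the field extension by complex multiplication*, Trans. AMS 118 (1965), §4 Lemma 2.
* [Gordon1999HodgeAVSurvey] B. B. Gordon, *A survey of the Hodge conjecture for abelian varieties*, Prop. 9.4.1.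
* [Shimura1998] G. Shimura, *Abelian Varieties with Complex Multiplication and Modular Functions*, §8.4 Example (2)(A).
* [Ribet1980] K. A. Ribet, *Division fields of abelian varieties with complex multiplication*, §3 (3.5), (3.7).

## Provenance

Lane `lit-hodgefound` (Track 2, Layer A3), seat `lit-hodgefound-p10` generation 38, row g38-#2; neighbours cited by
name, nothing restated: `DegenerateCMTypesElementaryAbelianTwoGroup` (`ExponentTwo.sum_char_eq_zero_of_even`, the
exponent-`2` predecessor `ExponentTwo.typeRank_eq_two_iff_exists_subgroup`), `DegenerateCMTypesAbelianKernels`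
(`AbelianKernels.exists_oddChar_ker`), `CMTypeRankCharacters` (`IsCMTypeWith.typeRank_eq_one_add_ncard_oddCharacters`),
`CMTypeElementaryTwoGroupOddWeights` (`character_apply_eq_one_or_of_mul_self`), Mathlib `AddChar.sum_apply_eq_ite`,
`AddChar.norm_apply`, `Complex.normSq_sub`.
-/

open scoped BigOperators Classical ComplexConjugate

namespace Literature.NumberTheory.ComplexMultiplication

namespace CyclicCMType

namespace AbelianRankTwo

variable {G : Type*} [CommGroup G] [Fintype G] [DecidableEq G] {ρ : G} {T : Finset G}

/-! ## §0 Helpers -/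

section Helpers

omit [Fintype G] [DecidableEq G] in
/-- `χ(gh) = χ(g)χ(h)`. [folklore] -/
private theorem char_mul (χ : AddChar (Additive G) ℂ) (g h : G) :
    χ (Additive.ofMul (g * h)) = χ (Additive.ofMul g) * χ (Additive.ofMul h) := by
  rw [ofMul_mul, AddChar.map_add_eq_mul]

omit [Fintype G] [DecidableEq G] in
/-- `χ(g⁻¹) = χ(g)⁻¹`. [folklore] -/
private theorem char_inv (χ : AddChar (Additive G) ℂ) (g : G) :
    χ (Additive.ofMul g⁻¹) = (χ (Additive.ofMul g))⁻¹ := by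
  rw [ofMul_inv, AddChar.map_neg_eq_inv]

omit [DecidableEq G] in
/-- `|χ(g)| = 1` (Mathlib `AddChar.norm_apply`). [folklore] -/
private theorem norm_char (χ : AddChar (Additive G) ℂ) (g : G) : ‖χ (Additive.ofMul g)‖ = 1 :=
  AddChar.norm_apply χ (Additive.ofMul g)

omit [DecidableEq G] in
/-- `|χ(g)|² = 1`. [folklore] -/
private theorem normSq_char (χ : AddChar (Additive G) ℂ) (g : G) : Complex.normSq (χ (Additive.ofMul g)) = 1 := by
  rw [Complex.normSq_eq_norm_sq, norm_char]; norm_num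

omit [DecidableEq G] in
/-- `conj χ(g) = χ(g⁻¹)` (unit complex numbers). [folklore] -/
private theorem conj_char (χ : AddChar (Additive G) ℂ) (g : G) :
    conj (χ (Additive.ofMul g)) = χ (Additive.ofMul g⁻¹) := by
  have h1 : χ (Additive.ofMul g) * conj (χ (Additive.ofMul g)) = 1 := by
    rw [Complex.mul_conj, normSq_char]; norm_num
  rw [char_inv]
  exact eq_inv_of_mul_eq_one_right h1

omit [DecidableEq G] in
/-- `χ(g) ≠ 0`. [folklore] -/
private theorem char_ne_zero (χ : AddChar (Additive G) ℂ) (g : G) : χ (Additive.ofMul g) ≠ 0 := by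
  intro h0
  have := norm_char χ g
  rw [h0, norm_zero] at this
  exact zero_ne_one this

/-- Dual orthogonality: `Σ_χ χ(x) = |G|·[x = 1]` (Mathlib `AddChar.sum_apply_eq_ite`). [folklore] -/
private theorem sum_char_apply_eq_ite (x : G) :
    ∑ χ : AddChar (Additive G) ℂ, χ (Additive.ofMul x) = if x = 1 then (Fintype.card G : ℂ) else 0 := by
  have h := AddChar.sum_apply_eq_ite (α := Additive G) (Additive.ofMul x)
  have hc : Fintype.card (Additive G) = Fintype.card G := Fintype.card_congr Additive.toMul
  rw [h, hc]
  rfl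

omit [Fintype G] [DecidableEq G] in
/-- `ρ² = 1`. [folklore] -/
private theorem rho_mul_rho (h : IsCMTypeWith ρ (T : Set G)) : ρ * ρ = 1 := by
  have := h.invol (1 : G)
  simpa [smul_eq_mul] using this

omit [Fintype G] [DecidableEq G] in
/-- `ρx ∈ T ⟺ x ∉ T`. [folklore] -/
private theorem rho_mul_mem_iff (h : IsCMTypeWith ρ (T : Set G)) (x : G) : ρ * x ∈ T ↔ x ∉ T := by
  have := h.rho_smul_mem_iff x
  simpa only [smul_eq_mul, Finset.mem_coe] using this

omit [Fintype G] [DecidableEq G] in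
/-- `χ(ρ) = ±1`. [folklore] -/
private theorem char_rho (h : IsCMTypeWith ρ (T : Set G)) (χ : AddChar (Additive G) ℂ) :
    χ (Additive.ofMul ρ) = 1 ∨ χ (Additive.ofMul ρ) = -1 :=
  character_apply_eq_one_or_of_mul_self χ (rho_mul_rho h)

/-- `2|T| = |G|`. [folklore] -/
private theorem two_mul_card (h : IsCMTypeWith ρ (T : Set G)) : 2 * T.card = Fintype.card G := by
  have hinj : Function.Injective fun s : G => ρ * s := fun a b hab => mul_left_cancel hab
  have hc : Tᶜ = T.image fun s => ρ * s := by
    ext x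
    rw [Finset.mem_compl, Finset.mem_image]
    constructor
    · intro hx
      refine ⟨ρ * x, (rho_mul_mem_iff h x).2 hx, ?_⟩
      show ρ * (ρ * x) = x
      rw [← mul_assoc, rho_mul_rho h, one_mul]
    · rintro ⟨s, hs, rfl⟩
      exact fun hx => ((rho_mul_mem_iff h s).1 hx) hs
  have h1 : Tᶜ.card = T.card := by rw [hc, Finset.card_image_of_injective _ hinj]
  have h2 := Finset.card_add_card_compl T
  omega

/-- `T` is nonempty. [folklore] -/
private theorem nonempty (h : IsCMTypeWith ρ (T : Set G)) : T.Nonempty := by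
  rw [← Finset.card_pos]
  have := two_mul_card h
  have : 0 < Fintype.card G := Fintype.card_pos
  omega

end Helpers

/-! ## §1 Parseval for subsets of a finite commutative group -/

section Parseval

/-- **`Σ_χ Ŝ_S(χ)·conj Ŝ_S(χ) = |G|·|S|`** (`conj χ(t) = χ(t⁻¹)`, `Σ_χ χ(st⁻¹) = |G|·[s = t]`). [cite: Kubota1965, §4 Lemma 2 (proof)] -/
theorem sum_mul_conj_sum_char_eq (S : Finset G) :
    ∑ χ : AddChar (Additive G) ℂ, (∑ s ∈ S, χ (Additive.ofMul s)) * conj (∑ s ∈ S, χ (Additive.ofMul s)) =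
      (Fintype.card G : ℂ) * S.card := by
  calc ∑ χ : AddChar (Additive G) ℂ, (∑ s ∈ S, χ (Additive.ofMul s)) * conj (∑ s ∈ S, χ (Additive.ofMul s))
      = ∑ χ : AddChar (Additive G) ℂ, ∑ s ∈ S, ∑ t ∈ S, χ (Additive.ofMul (s * t⁻¹)) := by
        refine Finset.sum_congr rfl fun χ _ => ?_
        rw [map_sum, Finset.sum_mul_sum]
        refine Finset.sum_congr rfl fun s _ => Finset.sum_congr rfl fun t _ => ?_
        rw [conj_char, char_mul]
    _ = ∑ s ∈ S, ∑ t ∈ S, ∑ χ : AddChar (Additive G) ℂ, χ (Additive.ofMul (s * t⁻¹)) := by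
        rw [Finset.sum_comm]
        exact Finset.sum_congr rfl fun s _ => Finset.sum_comm
    _ = ∑ s ∈ S, ∑ t ∈ S, (if s = t then (Fintype.card G : ℂ) else 0) := by
        refine Finset.sum_congr rfl fun s _ => Finset.sum_congr rfl fun t _ => ?_
        rw [sum_char_apply_eq_ite]
        simp only [mul_inv_eq_one]
    _ = ∑ s ∈ S, (Fintype.card G : ℂ) := by
        refine Finset.sum_congr rfl fun s hs => ?_
        rw [Finset.sum_ite_eq, if_pos hs]
    _ = (Fintype.card G : ℂ) * S.card := by rw [Finset.sum_const, nsmul_eq_mul, mul_comm]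

/-- **PARSEVAL**: `Σ_χ |Ŝ_S(χ)|² = |G|·|S|` for every subset `S` of a finite commutative group.
[cite: Kubota1965, §4 Lemma 2 (proof)] -/
theorem sum_normSq_sum_char_eq (S : Finset G) :
    ∑ χ : AddChar (Additive G) ℂ, Complex.normSq (∑ s ∈ S, χ (Additive.ofMul s)) =
      (Fintype.card G : ℝ) * S.card := by
  have h := sum_mul_conj_sum_char_eq S
  simp only [Complex.mul_conj] at h
  exact_mod_cast h

end Parseval

/-! ## §2 Parseval on a CM type: `Σ_{χ odd} |Ŝ(χ)|² = |T|²` -/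

section CMType

/-- **`Σ_{χ odd} |Ŝ(χ)|² = |T|²`** for a CM type `T`: in Parseval `Σ_χ |Ŝ(χ)|² = |G|·|T| = 2|T|²` the trivial
character gives `|T|²` and the even non-trivial ones vanish on `T`. [cite: Kubota1965, §4 Lemma 2] -/
theorem sum_odd_normSq_sum_char_eq (h : IsCMTypeWith ρ (T : Set G)) :
    ∑ χ ∈ Finset.univ.filter (fun χ : AddChar (Additive G) ℂ => χ (Additive.ofMul ρ) = -1),
      Complex.normSq (∑ s ∈ T, χ (Additive.ofMul s)) = (T.card : ℝ) ^ 2 := by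
  have hP := sum_normSq_sum_char_eq T
  rw [← Finset.sum_filter_add_sum_filter_not Finset.univ
      (fun χ : AddChar (Additive G) ℂ => χ (Additive.ofMul ρ) = -1)] at hP
  have h0mem : (0 : AddChar (Additive G) ℂ) ∈
      Finset.univ.filter (fun χ : AddChar (Additive G) ℂ => ¬ χ (Additive.ofMul ρ) = -1) := by
    rw [Finset.mem_filter, AddChar.zero_apply]
    exact ⟨Finset.mem_univ _, by norm_num⟩
  have heven : ∑ χ ∈ Finset.univ.filter (fun χ : AddChar (Additive G) ℂ => ¬ χ (Additive.ofMul ρ) = -1),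
      Complex.normSq (∑ s ∈ T, χ (Additive.ofMul s)) = (T.card : ℝ) ^ 2 := by
    rw [Finset.sum_eq_single_of_mem (0 : AddChar (Additive G) ℂ) h0mem]
    · simp only [AddChar.zero_apply, Finset.sum_const, nsmul_eq_mul, mul_one]
      rw [Complex.normSq_natCast]; ring
    · intro χ hχ hne
      have hχρ : χ (Additive.ofMul ρ) = 1 := (char_rho h χ).resolve_right (Finset.mem_filter.1 hχ).2
      rw [ExponentTwo.sum_char_eq_zero_of_even h hχρ hne, map_zero]
  have hT : (Fintype.card G : ℝ) = 2 * T.card := by exact_mod_cast (two_mul_card h).symm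
  rw [heven, hT] at hP
  linarith

/-- Some odd character survives (`Σ_{odd} |Ŝ|² = |T|² > 0`). [cite: Kubota1965, §4 Lemma 2] -/
theorem exists_odd_sum_char_ne_zero (h : IsCMTypeWith ρ (T : Set G)) :
    ∃ χ : AddChar (Additive G) ℂ, χ (Additive.ofMul ρ) = -1 ∧ ∑ s ∈ T, χ (Additive.ofMul s) ≠ 0 := by
  by_contra hno
  have hz : ∑ χ ∈ Finset.univ.filter (fun χ : AddChar (Additive G) ℂ => χ (Additive.ofMul ρ) = -1),
      Complex.normSq (∑ s ∈ T, χ (Additive.ofMul s)) = 0 := by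
    refine Finset.sum_eq_zero fun χ hχ => ?_
    have hχρ := (Finset.mem_filter.1 hχ).2
    have : ∑ s ∈ T, χ (Additive.ofMul s) = 0 := by
      by_contra hne
      exact hno ⟨χ, hχρ, hne⟩
    rw [this, map_zero]
  rw [sum_odd_normSq_sum_char_eq h] at hz
  have hpos : 0 < T.card := Finset.card_pos.2 (nonempty h)
  have : (0 : ℝ) < (T.card : ℝ) ^ 2 := by positivity
  linarith

end CMType

/-! ## §3 The variance identity; rank `2` iff an odd character is constant on the type -/

section Variance

omit [DecidableEq G] in
/-- **VARIANCE**: if `|Ŝ_S(χ)|² = |S|²` for a nonempty `S`, then `χ` is constant on `S`.  With `c = Ŝ/|S|`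
(`|c| = 1`): `Σ_{s∈S} |χ(s) − c|² = |S| + |S|·|c|² − 2·Re(Ŝ·c̄) = 0`. [cite: Kubota1965, §4 Lemma 2 (proof)] -/
theorem forall_eq_of_normSq_sum_char_eq (χ : AddChar (Additive G) ℂ) {S : Finset G} (hS : S.Nonempty)
    (hsq : Complex.normSq (∑ s ∈ S, χ (Additive.ofMul s)) = (S.card : ℝ) ^ 2) :
    ∀ s ∈ S, ∀ t ∈ S, χ (Additive.ofMul s) = χ (Additive.ofMul t) := by
  have hn : (0 : ℝ) < S.card := by exact_mod_cast Finset.card_pos.2 hS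
  set Z : ℂ := ∑ s ∈ S, χ (Additive.ofMul s) with hZ
  set c : ℂ := Z / (S.card : ℂ) with hc
  have hZc : Z = (S.card : ℂ) * c := by
    rw [hc, mul_div_cancel₀]
    exact_mod_cast hn.ne'
  have hcn : Complex.normSq c = 1 := by
    rw [hc, map_div₀, hsq, Complex.normSq_natCast]
    field_simp
  -- the variance vanishes
  have hvar : ∑ s ∈ S, Complex.normSq (χ (Additive.ofMul s) - c) = 0 := by
    have hterm : ∀ s ∈ S, Complex.normSq (χ (Additive.ofMul s) - c) =
        2 - 2 * (χ (Additive.ofMul s) * conj c).re := by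
      intro s _
      rw [Complex.normSq_sub, normSq_char, hcn]; ring
    rw [Finset.sum_congr rfl hterm, Finset.sum_sub_distrib, Finset.sum_const, nsmul_eq_mul, ← Finset.mul_sum,
      ← Complex.re_sum, ← Finset.sum_mul]
    have hre : (Z * conj c).re = S.card := by
      rw [hZc, mul_assoc, Complex.mul_conj, hcn]
      simp
    rw [← hZ, hre]
    ring
  -- each term vanishes
  have hzero : ∀ s ∈ S, χ (Additive.ofMul s) = c := by
    intro s hs
    have h0 := (Finset.sum_eq_zero_iff_of_nonneg fun t _ => Complex.normSq_nonneg _).1 hvar s hs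
    exact sub_eq_zero.1 (Complex.normSq_eq_zero.1 h0)
  intro s hs t ht
  rw [hzero s hs, hzero t ht]

/-- **Rank `2` ⟹ the unique survivor `χ₀` has `|Ŝ(χ₀)|² = |T|²** (Kubota leaves one survivor; Parseval on the
type gives it all the mass). [cite: Kubota1965, §4 Lemma 2] -/
theorem normSq_sum_char_eq_of_typeRank_eq_two (h : IsCMTypeWith ρ (T : Set G)) (hr : typeRank G (T : Set G) = 2)
    {χ₀ : AddChar (Additive G) ℂ} (hχ₀ : χ₀ (Additive.ofMul ρ) = -1) (hne : ∑ s ∈ T, χ₀ (Additive.ofMul s) ≠ 0) :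
    Complex.normSq (∑ s ∈ T, χ₀ (Additive.ofMul s)) = (T.card : ℝ) ^ 2 := by
  -- exactly one survivor, namely `χ₀`
  have hn : {χ : AddChar (Additive G) ℂ | χ (Additive.ofMul ρ) = -1 ∧
      ∑ s ∈ T, χ (Additive.ofMul s) ≠ 0}.ncard = 1 := by
    have := h.typeRank_eq_one_add_ncard_oddCharacters
    omega
  obtain ⟨χ₁, hχ₁⟩ := Set.ncard_eq_one.1 hn
  have hχ₀mem : χ₀ ∈ {χ : AddChar (Additive G) ℂ | χ (Additive.ofMul ρ) = -1 ∧
      ∑ s ∈ T, χ (Additive.ofMul s) ≠ 0} := ⟨hχ₀, hne⟩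
  rw [hχ₁] at hχ₀mem
  have h01 : χ₀ = χ₁ := Set.mem_singleton_iff.1 hχ₀mem
  have hvan : ∀ χ ∈ Finset.univ.filter (fun χ : AddChar (Additive G) ℂ => χ (Additive.ofMul ρ) = -1),
      χ ≠ χ₀ → Complex.normSq (∑ s ∈ T, χ (Additive.ofMul s)) = 0 := by
    intro χ hχ hneχ
    have hχρ := (Finset.mem_filter.1 hχ).2
    have : ∑ s ∈ T, χ (Additive.ofMul s) = 0 := by
      by_contra hS
      have hmem : χ ∈ ({χ₁} : Set (AddChar (Additive G) ℂ)) := by rw [← hχ₁]; exact ⟨hχρ, hS⟩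
      exact hneχ ((Set.mem_singleton_iff.1 hmem).trans h01.symm)
    rw [this, map_zero]
  have hP := sum_odd_normSq_sum_char_eq h
  have hχ₀O : χ₀ ∈ Finset.univ.filter (fun χ : AddChar (Additive G) ℂ => χ (Additive.ofMul ρ) = -1) :=
    Finset.mem_filter.2 ⟨Finset.mem_univ _, hχ₀⟩
  rw [← Finset.add_sum_erase _ _ hχ₀O, Finset.sum_eq_zero fun χ hχ =>
    hvan χ (Finset.mem_of_mem_erase hχ) (Finset.ne_of_mem_erase hχ), add_zero] at hP
  exact hP

/-- **An odd character CONSTANT on `T` is the only surviving one, so `rank(T) = 2`**: every other odd `χ` is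
`ψχ₀` with `ψ` even and non-trivial, which vanishes on the CM type. [cite: Kubota1965, §4 Lemma 2]
[cite: Shimura1998, §8.4 Example (2)(A)] -/
theorem typeRank_eq_two_of_forall_eq (h : IsCMTypeWith ρ (T : Set G)) {χ₀ : AddChar (Additive G) ℂ}
    (hχ₀ : χ₀ (Additive.ofMul ρ) = -1)
    (hconst : ∀ s ∈ T, ∀ t ∈ T, χ₀ (Additive.ofMul s) = χ₀ (Additive.ofMul t)) :
    typeRank G (T : Set G) = 2 := by
  obtain ⟨s₀, hs₀⟩ := nonempty h
  have hTpos : 0 < T.card := Finset.card_pos.2 ⟨s₀, hs₀⟩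
  have hχ₀sum : ∑ s ∈ T, χ₀ (Additive.ofMul s) = T.card * χ₀ (Additive.ofMul s₀) := by
    rw [Finset.sum_congr rfl fun s hs => hconst s hs s₀ hs₀, Finset.sum_const, nsmul_eq_mul]
  have hχ₀ne : ∑ s ∈ T, χ₀ (Additive.ofMul s) ≠ 0 := by
    rw [hχ₀sum]
    exact mul_ne_zero (by exact_mod_cast hTpos.ne') (char_ne_zero χ₀ s₀)
  have hother : ∀ χ : AddChar (Additive G) ℂ, χ (Additive.ofMul ρ) = -1 → χ ≠ χ₀ →
      ∑ s ∈ T, χ (Additive.ofMul s) = 0 := by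
    intro χ hχ hneχ
    have hψρ : (χ - χ₀) (Additive.ofMul ρ) = 1 := by
      rw [AddChar.sub_apply', hχ, hχ₀]; norm_num
    have hψ : χ - χ₀ ≠ 0 := fun h0 => hneχ (sub_eq_zero.1 h0)
    have h0 := ExponentTwo.sum_char_eq_zero_of_even h hψρ hψ
    have hfac : ∀ s ∈ T, χ (Additive.ofMul s) = (χ - χ₀) (Additive.ofMul s) * χ₀ (Additive.ofMul s₀) := by
      intro s hs
      rw [AddChar.sub_apply', ← hconst s hs s₀ hs₀, div_mul_cancel₀ _ (char_ne_zero χ₀ s)]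
    rw [Finset.sum_congr rfl hfac, ← Finset.sum_mul, h0, zero_mul]
  have hset : {χ : AddChar (Additive G) ℂ | χ (Additive.ofMul ρ) = -1 ∧ ∑ s ∈ T, χ (Additive.ofMul s) ≠ 0} = {χ₀} := by
    ext χ
    simp only [Set.mem_setOf_eq, Set.mem_singleton_iff]
    constructor
    · rintro ⟨hχ, hneS⟩
      by_contra hχne
      exact hneS (hother χ hχ hχne)
    · rintro rfl
      exact ⟨hχ₀, hχ₀ne⟩
  rw [h.typeRank_eq_one_add_ncard_oddCharacters, hset, Set.ncard_singleton]

/-- **RANK `2` ⟺ SOME ODD CHARACTER IS CONSTANT ON THE TYPE**, on every finite commutative group.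
[cite: Kubota1965, §4 Lemma 2] [cite: Shimura1998, §8.4 Example (2)(A)] -/
theorem typeRank_eq_two_iff_exists_forall_eq (h : IsCMTypeWith ρ (T : Set G)) :
    typeRank G (T : Set G) = 2 ↔ ∃ χ : AddChar (Additive G) ℂ, χ (Additive.ofMul ρ) = -1 ∧
      ∀ s ∈ T, ∀ t ∈ T, χ (Additive.ofMul s) = χ (Additive.ofMul t) := by
  constructor
  · intro hr
    obtain ⟨χ₀, hχ₀, hne⟩ := exists_odd_sum_char_ne_zero h
    exact ⟨χ₀, hχ₀, forall_eq_of_normSq_sum_char_eq χ₀ (nonempty h)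
      (normSq_sum_char_eq_of_typeRank_eq_two h hr hχ₀ hne)⟩
  · rintro ⟨χ₀, hχ₀, hconst⟩
    exact typeRank_eq_two_of_forall_eq h hχ₀ hconst

end Variance

/-! ## §4 Rank `2` iff a coset of an index-`2` subgroup not containing `ρ` -/

section Coset

/-- **An odd character constant on a CM type has a kernel `H` of index `2`, `ρ ∉ H`, and the type is `H` or
`G ∖ H`**: `T` lies in one fibre of `χ₀`, a coset of `H = ker χ₀`, and `|H| ≤ |G|/2 = |T|` as `χ₀ ≠ 1`.
[cite: Kubota1965, §4 Lemma 2] [cite: Shimura1998, §8.4 Example (2)(A)] -/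
theorem exists_subgroup_of_forall_eq (h : IsCMTypeWith ρ (T : Set G)) {χ₀ : AddChar (Additive G) ℂ}
    (hχ₀ : χ₀ (Additive.ofMul ρ) = -1)
    (hconst : ∀ s ∈ T, ∀ t ∈ T, χ₀ (Additive.ofMul s) = χ₀ (Additive.ofMul t)) :
    ∃ H : Subgroup G, ρ ∉ H ∧ H.index = 2 ∧ (∀ g : G, g ∈ H ↔ χ₀ (Additive.ofMul g) = 1) ∧
      ((T : Set G) = (H : Set G) ∨ (T : Set G) = (H : Set G)ᶜ) := by
  let H : Subgroup G := MonoidHom.ker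
    { toFun := fun g => χ₀ (Additive.ofMul g)
      map_one' := by rw [ofMul_one, AddChar.map_zero_eq_one]
      map_mul' := fun a b => char_mul χ₀ a b }
  have hH : ∀ g : G, g ∈ H ↔ χ₀ (Additive.ofMul g) = 1 := fun g => by rw [MonoidHom.mem_ker]; rfl
  have hρH : ρ ∉ H := fun hρ => by
    have := (hH ρ).1 hρ
    rw [hχ₀] at this
    norm_num at this
  obtain ⟨s₀, hs₀⟩ := nonempty h
  -- `T ⊆ s₀H`
  have hsub : ∀ t ∈ T, t * s₀⁻¹ ∈ H := by
    intro t ht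
    rw [hH, char_mul, char_inv, hconst t ht s₀ hs₀, mul_inv_cancel₀ (char_ne_zero χ₀ s₀)]
  have hTsub : T ⊆ Finset.univ.filter (fun g : G => g * s₀⁻¹ ∈ H) := fun t ht =>
    Finset.mem_filter.2 ⟨Finset.mem_univ _, hsub t ht⟩
  -- `|s₀H| = |H|`
  have hcoset : (Finset.univ.filter fun g : G => g * s₀⁻¹ ∈ H).card = Nat.card H := by
    rw [Nat.card_eq_fintype_card, ← Finset.card_image_of_injective
      (Finset.univ.filter fun g : G => g * s₀⁻¹ ∈ H) (mul_left_injective s₀⁻¹)]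
    rw [Fintype.card_subtype]
    congr 1
    ext x
    simp only [Finset.mem_image, Finset.mem_filter, Finset.mem_univ, true_and]
    constructor
    · rintro ⟨g, hg, rfl⟩; exact hg
    · intro hx; exact ⟨x * s₀, by rwa [mul_inv_cancel_right], mul_inv_cancel_right x s₀⟩
  -- `|H| ≤ |G|/2`
  have hHtop : H ≠ ⊤ := fun htop => hρH (htop ▸ Subgroup.mem_top ρ)
  have hidx2 : 2 ≤ H.index := Subgroup.one_lt_index_of_ne_top hHtop
  have hmul := H.card_mul_index
  rw [Nat.card_eq_fintype_card (α := G)] at hmul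
  have hT := two_mul_card h
  have hHle : 2 * Nat.card H ≤ Fintype.card G := by
    calc 2 * Nat.card H = Nat.card H * 2 := by ring
      _ ≤ Nat.card H * H.index := Nat.mul_le_mul_left _ hidx2
      _ = Fintype.card G := hmul
  -- hence `T = s₀H` and `[G:H] = 2`
  have hcard_eq : T.card = Nat.card H := by
    have h1 := Finset.card_le_card hTsub
    rw [hcoset] at h1
    omega
  have hTeq : T = Finset.univ.filter (fun g : G => g * s₀⁻¹ ∈ H) :=
    Finset.eq_of_subset_of_card_le hTsub (by rw [hcoset, hcard_eq])
  have hidx : H.index = 2 := by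
    have hpos : 0 < Nat.card H := by rw [← hcard_eq]; exact Finset.card_pos.2 ⟨s₀, hs₀⟩
    have : Nat.card H * H.index = Nat.card H * 2 := by rw [hmul]; omega
    exact Nat.eq_of_mul_eq_mul_left hpos this
  refine ⟨H, hρH, hidx, hH, ?_⟩
  by_cases hs₀H : s₀ ∈ H
  · left
    ext g
    rw [Finset.mem_coe, hTeq, Finset.mem_filter, SetLike.mem_coe]
    simp only [Finset.mem_univ, true_and]
    constructor
    · intro hg; simpa using H.mul_mem hg hs₀H
    · intro hg; exact H.mul_mem hg (H.inv_mem hs₀H)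
  · right
    ext g
    rw [Finset.mem_coe, hTeq, Finset.mem_filter, Set.mem_compl_iff, SetLike.mem_coe]
    simp only [Finset.mem_univ, true_and]
    constructor
    · intro hg hgH
      exact hs₀H (by simpa using H.mul_mem (H.inv_mem hg) hgH)
    · intro hg
      rw [Subgroup.mul_mem_iff_of_index_two hidx]
      simp only [hg, Subgroup.inv_mem_iff, hs₀H]

/-- **RANK `2` ⟺ THE TYPE IS A COSET OF AN INDEX-`2` SUBGROUP `H ∌ ρ`** (`T = H` or `T = G ∖ H = ρH`), for a CM
type on ANY finite commutative group — on the field side: iff the type of the abelian CM field `K` is the set of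
all extensions of a CM type of the imaginary quadratic subfield `K^H`.  The tree's
`ExponentTwo.typeRank_eq_two_iff_exists_subgroup` without the exponent-`2` hypothesis.
[cite: Kubota1965, §4 Lemma 2] [cite: Shimura1998, §8.4 Example (2)(A)] -/
theorem typeRank_eq_two_iff_exists_subgroup (h : IsCMTypeWith ρ (T : Set G)) :
    typeRank G (T : Set G) = 2 ↔ ∃ H : Subgroup G, ρ ∉ H ∧ H.index = 2 ∧
      ((T : Set G) = (H : Set G) ∨ (T : Set G) = (H : Set G)ᶜ) := by
  rw [typeRank_eq_two_iff_exists_forall_eq h]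
  constructor
  · rintro ⟨χ₀, hχ₀, hconst⟩
    obtain ⟨H, hρH, hidx, -, hT⟩ := exists_subgroup_of_forall_eq h hχ₀ hconst
    exact ⟨H, hρH, hidx, hT⟩
  · rintro ⟨H, hρH, hidx, hT⟩
    haveI : Fact (Nat.Prime 2) := ⟨Nat.prime_two⟩
    have hcyc : IsCyclic (G ⧸ H) := isCyclic_of_prime_card (p := 2) (by rw [← Subgroup.index_eq_card, hidx])
    obtain ⟨χ, hχρ, hker⟩ := AbelianKernels.exists_oddChar_ker hρH (rho_mul_rho h) hcyc
    refine ⟨χ, hχρ, ?_⟩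
    -- `χ` is constant on each coset of `H`
    have hcos : ∀ s t : G, (s ∈ H ↔ t ∈ H) → χ (Additive.ofMul s) = χ (Additive.ofMul t) := by
      intro s t hst
      have hmem : s * t⁻¹ ∈ H := by
        rw [Subgroup.mul_mem_iff_of_index_two hidx, Subgroup.inv_mem_iff]
        exact hst
      have h1 := (hker (s * t⁻¹)).2 hmem
      rw [char_mul, char_inv, mul_inv_eq_one₀ (char_ne_zero χ t)] at h1
      exact h1
    intro s hs t ht
    refine hcos s t ?_
    rcases hT with hT | hT
    · have hs' : s ∈ (H : Set G) := by rw [← hT]; exact Finset.mem_coe.2 hs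
      have ht' : t ∈ (H : Set G) := by rw [← hT]; exact Finset.mem_coe.2 ht
      exact ⟨fun _ => ht', fun _ => hs'⟩
    · have hs' : s ∈ (H : Set G)ᶜ := by rw [← hT]; exact Finset.mem_coe.2 hs
      have ht' : t ∈ (H : Set G)ᶜ := by rw [← hT]; exact Finset.mem_coe.2 ht
      exact ⟨fun hsH => absurd hsH hs', fun htH => absurd htH ht'⟩

/-- **Rank `2` ⟹ an index-`2` subgroup missing `ρ` exists** (so `4 ∣ |G|` fails only for `|G| = 2`; on the field
side an imaginary quadratic subfield over which the type is induced). [cite: Kubota1965, §4 Lemma 2] -/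
theorem exists_index_two_of_typeRank_eq_two (h : IsCMTypeWith ρ (T : Set G)) (hr : typeRank G (T : Set G) = 2) :
    ∃ H : Subgroup G, ρ ∉ H ∧ H.index = 2 :=
  let ⟨H, hρH, hidx, _⟩ := (typeRank_eq_two_iff_exists_subgroup h).1 hr
  ⟨H, hρH, hidx⟩

end Coset

end AbelianRankTwo

end CyclicCMType

end Literature.NumberTheory.ComplexMultiplication
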